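import Summits.CriticalPhenomena.PercolationContinuityZ3.Theorems.PercNearOneGluingNoHeavyLowerTailSahiChordSuperlinear

/-!
# `NoHeavyLowerTail` (stmt-CriticalPhenomena-4575) — REFUTATION of the per-coordinate chord-superlinearity conjecture:
# `¬ ChordSuperlinear 5`

Support file, seat `prim-l12-p5`, `--supports stmt-CriticalPhenomena-4575`.  Refutes BY NAME the obligation
`SahiChordSuperlinear.ChordSuperlinear 5` filed by the same seat (p198879).  WITNESS: the cube `Fin 6 → Bool` with the product
weight `q ≡ 2/3` and the monotone indicator triple
  `f₀ = (x₀∨x₁)∧(x₂∨x₃∨x₄∨x₅)`, `f₁ = (x₀∨x₁∨x₂∨x₃)∧(x₄∨x₅)`, `f₂ = (x₂∨x₃)∧(x₀∨x₁∨x₄∨x₅)`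
— the "star-α" triple `P∧(Q∨R), (P∨Q)∧R, Q∧(P∨R)` of `K_{1,3}` with every variable replaced by an OR of two i.i.d. coins; found
by the ttrl2 census (cp-sahi2, 2026-08-20) as the star `K_{1,4}` with two doubled edges and an increasing group-connection triple,
re-verified exactly by the seat.  For EVERY coordinate `j`: `E₃(section x_j = 1) = 0` (zero locus), `E₃(section x_j = 0) =
17152/3¹⁵`, `E₃ = 123904/3¹⁸`, so `E₃ − [(1/3)·E₃⁰ + (2/3)·E₃¹] = −30464/3¹⁸ < 0`.  Hence "chord superlinearity along SOME
coordinate" fails at `k = 6` (it holds on all sampled `{0,1}^k`, `k ≤ 4`, and on the un-doubled triple): the property is not stable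
under `x ↦ x ∨ x′`.  The reduction `sahiPositive_three_of_chordSuperlinear` stands, with an unsatisfiable hypothesis; the surviving
(censused, unrefuted) form is SUBSET chord superlinearity — some nonempty proper block `S` with `E₃ ≥ E[E₃ | x_S]` — see the seat
report run/shared/lean/prim/prim-l12/prim-l12-p5/FBP-REFUTED.md.

Technique: `sum_cube_succ` peels one coin off a sum over `Fin (n+1) → Bool`; `ex_cubeSection_eq` writes a section expectation as
a restricted sum over the big cube (so no `Fin.insertNth` has to be evaluated); then `fin_cases` on the coordinate and exact
evaluation of the 64-point sums (`simp` + `norm_num`; a raised heartbeat budget for this finite computation only).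
-/

namespace Summit.CriticalPhenomena.PercolationContinuityZ3.Theorems

namespace SahiChordSuperlinear

open Finset Literature.Combinatorics.Sahi2008

/-- Peel the first coin: `Σ_{x ∈ {0,1}^{n+1}} g(x) = Σ_{x ∈ {0,1}^n} (g(0∷x) + g(1∷x))`. [folklore] -/
theorem sum_cube_succ {n : ℕ} (g : (Fin (n + 1) → Bool) → ℝ) :
    ∑ x, g x = ∑ x : Fin n → Bool, (g (Matrix.vecCons false x) + g (Matrix.vecCons true x)) := by
  rw [← (Fin.consEquiv fun _ => Bool).sum_comp, Fintype.sum_prod_type, Fintype.sum_bool, Finset.sum_add_distrib,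
    add_comm]
  rfl

/-- The sum over the one-point cube `Fin 0 → Bool`. [folklore] -/
theorem sum_cube_zero (g : (Fin 0 → Bool) → ℝ) : ∑ x, g x = g ![] := by
  rw [Fintype.sum_unique]
  exact congrArg g (Subsingleton.elim _ _)

/-- Products of sections are sections of products. [folklore] -/
theorem mul_cubeSection {k : ℕ} (j : Fin (k + 1)) (b : Bool) (F G : (Fin (k + 1) → Bool) → ℝ) :
    cubeSection j b F * cubeSection j b G = cubeSection j b (F * G) := rfl

/-- A section expectation as a restricted sum over the big cube:
`(weight of b at j) · E_{q∘succAbove}[F ∘ ins_j^b] = Σ_y [y_j = b]·w_q(y)·F(y)`. [folklore] -/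
theorem ex_cubeSection_mul {n : ℕ} (q : Fin (n + 1) → ℝ) (j : Fin (n + 1)) (b : Bool) (F : (Fin (n + 1) → Bool) → ℝ) :
    (if b then q j else 1 - q j) * ex (cubeWeight fun i => q (j.succAbove i)) (cubeSection j b F) =
      ∑ y : Fin (n + 1) → Bool, if y j = b then cubeWeight q y * F y else 0 := by
  rw [← (Fin.insertNthEquiv (fun _ => Bool) j).sum_comp, Fintype.sum_prod_type, Fintype.sum_bool]
  simp only [Fin.insertNthEquiv, Equiv.coe_fn_mk, Fin.insertNth_apply_same]
  have hw : ∀ (c : Bool) (x : Fin n → Bool), cubeWeight q (Fin.insertNth j c x) =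
      (if c then q j else 1 - q j) * cubeWeight (fun i => q (j.succAbove i)) x := by
    intro c x
    unfold cubeWeight
    rw [Fin.prod_univ_succAbove _ j]
    simp only [Fin.insertNth_apply_same, Fin.insertNth_apply_succAbove]
  cases b
  · simp only [Bool.true_eq_false, if_false, Finset.sum_const_zero, if_true, zero_add, hw, ex, cubeSection,
      Finset.mul_sum]
    exact Finset.sum_congr rfl fun x _ => by ring
  · simp only [if_true, Bool.false_eq_true, if_false, Finset.sum_const_zero, add_zero, hw, ex, cubeSection,
      Finset.mul_sum]
    exact Finset.sum_congr rfl fun x _ => by ring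

/-- Solved form of `ex_cubeSection_mul` when the weight is nonzero. [folklore] -/
theorem ex_cubeSection_eq {n : ℕ} (q : Fin (n + 1) → ℝ) (j : Fin (n + 1)) (b : Bool) (F : (Fin (n + 1) → Bool) → ℝ)
    (h : (if b then q j else 1 - q j) ≠ 0) :
    ex (cubeWeight fun i => q (j.succAbove i)) (cubeSection j b F) =
      (if b then q j else 1 - q j)⁻¹ * ∑ y : Fin (n + 1) → Bool, if y j = b then cubeWeight q y * F y else 0 := by
  rw [← ex_cubeSection_mul, ← mul_assoc, inv_mul_cancel₀ h, one_mul]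

/-- Monotone indicator functions of the cube from monotone Boolean predicates. [folklore] -/
theorem monotone_boolInd {k : ℕ} {g : (Fin k → Bool) → Bool}
    (hg : ∀ x y : Fin k → Bool, (∀ i, x i = true → y i = true) → g x = true → g y = true) :
    Monotone (fun x => if g x = true then (1 : ℝ) else 0) := by
  intro x y hxy
  have hle : ∀ i, x i = true → y i = true := fun i hi => by
    have := hxy i; rw [hi] at this; exact Bool.eq_true_of_true_le this
  simp only
  split_ifs with h1 h2
  · exact le_rfl
  · exact absurd (hg x y hle h1) h2
  · exact zero_le_one
  · exact le_rfl

set_option maxHeartbeats 4000000 in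
-- finite exact evaluation of 6 × 21 sums over the 64-point cube; nothing else is affected
/-- **Refutation: `ChordSuperlinear 5` is false.**  Witness: `q ≡ 2/3` on `Fin 6 → Bool` and the doubled star-α triple of the
module docstring; every one of the six coordinates violates the chord inequality (margin `−30464/3¹⁸`). [this file] -/
theorem not_chordSuperlinear_five : ¬ ChordSuperlinear 5 := by
  intro H
  let q : Fin 6 → ℝ := fun _ => 2/3
  let F : Fin 3 → (Fin 6 → Bool) → ℝ :=
    ![fun x => if ((x 0 || x 1) && (x 2 || x 3 || x 4 || x 5)) = true then 1 else 0,
      fun x => if ((x 0 || x 1 || x 2 || x 3) && (x 4 || x 5)) = true then 1 else 0,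
      fun x => if ((x 2 || x 3) && (x 0 || x 1 || x 4 || x 5)) = true then 1 else 0]
  have hq : ∀ i, 0 ≤ q i ∧ q i ≤ 1 := fun _ => by norm_num
  have ind01 : ∀ c : Bool, (if c = true then (1 : ℝ) else 0) = 0 ∨ (if c = true then (1 : ℝ) else 0) = 1 := by
    intro c; cases c <;> simp
  have hf : ∀ i x, F i x = 0 ∨ F i x = 1 := by
    intro i x
    fin_cases i <;> exact ind01 _
  have hmono : ∀ i, Monotone (F i) := by
    intro i
    fin_cases i <;> simp only [F] <;>
      refine monotone_boolInd fun x y hle h => ?_ <;>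
      · have h0 := hle 0; have h1 := hle 1; have h2 := hle 2; have h3 := hle 3; have h4 := hle 4; have h5 := hle 5
        simp only [Bool.and_eq_true, Bool.or_eq_true] at h ⊢
        tauto
  obtain ⟨j, hj⟩ := H q hq F hf hmono
  have hb0 : (if false then q j else 1 - q j) ≠ 0 := by norm_num [q]
  have hb1 : (if true then q j else 1 - q j) ≠ 0 := by norm_num [q]
  rw [sahiE_three_apply, sahiE_three_apply, sahiE_three_apply] at hj
  simp only [mul_cubeSection, ex_cubeSection_eq _ _ _ _ hb0, ex_cubeSection_eq _ _ _ _ hb1] at hj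
  fin_cases j <;>
  · simp only [q, F, ex, Pi.mul_apply, Matrix.cons_val_zero, Matrix.cons_val_one, Matrix.cons_val, sum_cube_succ,
      sum_cube_zero, cubeWeight, Fin.prod_univ_succ, Fin.prod_univ_zero, Matrix.cons_val_succ, Fin.isValue,
      Bool.false_or, Bool.true_or, Bool.and_true, Bool.true_and, Bool.false_and, if_true, if_false,
      Bool.false_eq_true] at hj
    norm_num at hj

end SahiChordSuperlinear

end Summit.CriticalPhenomena.PercolationContinuityZ3.Theorems
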